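/-
Origin: expansion seat `planner-pub-hodgecm-pv06-g4-0`, handover (R)(b) 2026-08-18T08:49:45Z doc-only (`HOME/pub-hodgecm-pv06-g4/replace/HodgeCM/PerL34/AnnihilationRep.lean`, md5 815a2001, 371 lines);
landed by the gen-7 packager in gate run 27 REPLACES the earlier landed copy of `HodgeCM/PerL34/AnnihilationRep.lean` (seat copy carried the packager origin header of the earlier run (stripped)).
-/
/-
Doc-only v2 (2026-08-18, expansion seat planner-pub-hodgecm-pv06-g4-0, unit pub-hodgecm-pv06-g4; source
`HOME/pub-hodgecm-pv06-g4/replace/HodgeCM/PerL34/AnnihilationRep.lean`): ONE docstring corrected (`RepAnnihilationDatum.emb_surj`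
locator "(l. 398)" ↦ ll. 405, 409–410, distinguished from the hypothesis ll. 399–400), per GAPS adv1 gen 13–16 item (c); every
declaration byte-identical to runs 25–26 (whole-file replacement, module name and imports unchanged, no downstream effect).
-/
/-
Origin: HOME/pub-hodgecm-pv06-g3/lean/Pv06g3/AnnihilationRep.lean — session planner-pub-hodgecm-pv06-g3-0 (unit
pub-hodgecm-pv06-g3, DAG-NODE PROVER #06 of 15, generation 3).  Intended final place: `HodgeCM/PerL34/AnnihilationRep.lean`
(namespace `HodgeCM.PerL34.Annihilation`, new names `RepAnnihilationDatum`, `repAnnih…`, `RepTorusCarrier.Analytic5`).  WIP import `Pv06g3.WeightProjection`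
↦ `HodgeCM.PerL34.WeightProjection` (my handover #4); the other imports are LANDED (`HodgeCM.PerL34.Annihilation` run 19,
`HodgeCM.Automorphic.ThetaCarrierRep` run 23).  Closed: nothing cited, nothing posited.

# N23c (PerL v5 Prop 3.6 Step 2, ll. 423–434) on the LIVE gen-3 carrier — with `Pw_def` a THEOREM

The landed `Annihilation.lean` proves Step 2 — "a vector orthogonal to every pseudo-Eisenstein vector `E^χ_f` has vanishing
`w`-part, `P_w v = 0`" — from a labelled record `AnnihilationDatum C D` over the gen-1 FROZEN interface (`IsolationCore`,
`TorusData`, whose `P_w` is an opaque field), one of whose fields is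

  `Pw_def : ∀ v, D.Pw v = ∫ t, conj (w t) • C.R (ιT t) v ∂μ`      ([DEFINITIONAL] there, because `D.Pw` was opaque).

On the live representation-theoretic carriers (`RepCoreCarrier C`, `RepTorusCarrier D`, run 23) `P_w` is DEFINED — the
orthogonal projection onto the closed joint `w`-eigenspace (`TorusCarrier.Pw := EwC.starProjection`) — and `Pw_def` is the
THEOREM `WeightProjection.RepTorusCarrier_Pw_apply` (handover #4).  This file re-runs Layer C of `Annihilation.lean` over the
gen-3 carrier with that field DELETED: `RepAnnihilationDatum C D` has `AnnihilationDatum`'s fields verbatim EXCEPT `Pw_def`,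
replaced by the two definitional data the theorem consumes —

* `R_cont  : ∀ v, Continuous fun t => C.R (ιT t) v` — [DEFINITIONAL] strong continuity of `R` on `L²([U(W)])` along the torus
  (over the cocompact model: `QuotientSmoothing.continuous_ρ_apply`);
* `Ew_eq   : D.Ew = RepDecomp.Ew C.R ιT w` — [DEFINITIONAL] the carrier's torus family `(D.torus, D.w)` is `(ιT, w)`
  (`rfl`, or `WeightProjection.Ew_comp_of_surjective` for a reindexing);

and the main theorem

  `RepAnnihilationDatum.AX8_annihilation (A) (hC : C.Analytic) (hT : ∀ h χ f, C.R h (D.E χ f) = D.E χ (D.ETransl h χ f)) :`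
  `   ∀ v, (∀ χ f, ⟪D.E χ f, v⟫ = 0) → D.toTorusCarrier.Pw v = 0`

whose conclusion is the FIELD TYPE of `RepTorusCarrier.Analytic.AX8_annihilation` verbatim (`hT` = its sibling field
`AX12_E_transl`, ll. 410–411; `hC` supplies unitarity AX9).  Layers A/B of `Annihilation.lean` (character orthogonality,
`proj`, `proj_comm`, `period_proj_self/_ne`) are reused unchanged; the Layer-C proofs are the landed ones, re-addressed.
-/
import Summits.HodgeConjecture.HodgeCM.PerL34.Annihilation_2
import Summits.HodgeConjecture.HodgeCM.Automorphic.ThetaCarrierRep_2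
import Summits.HodgeConjecture.HodgeCM.PerL34.WeightProjection

/-! PORT of `HodgeCM/PerL34/AnnihilationRep.lean` (HodgeCMPerL run 82) — verbatim mechanical port; provenance in the PORT header line. -/

set_option autoImplicit false

noncomputable section

namespace HodgeCM

namespace PerL34.Annihilation

open MeasureTheory Filter Topology

local notation "⟪" x ", " y "⟫" => @inner ℂ _ _ x y

section LayerCRep

variable {H HG CG G SK SigIdxG : Type}
variable [NormedAddCommGroup H] [InnerProductSpace ℂ H] [CompleteSpace H]
variable [NormedAddCommGroup HG] [InnerProductSpace ℂ HG] [CompleteSpace HG]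
variable [NormedAddCommGroup CG] [NormedSpace ℂ CG]
variable [Group G] [TopologicalSpace G] [TopologicalSpace SK]

/-- **The inputs of PerL v5 Prop 3.6 Step 2 (ll. 423–434) for one torus side `D` over the representation-theoretic
core `C`** — the fields of `AnnihilationDatum` verbatim (same labels), except that `Pw_def` is GONE (a theorem for the
defined `P_w`, `WeightProjection.RepTorusCarrier_Pw_apply`) and the two [DEFINITIONAL] data `R_cont`, `Ew_eq` it consumes
are added. -/
structure RepAnnihilationDatum (C : RepCoreCarrier H HG CG G SK SigIdxG) (D : RepTorusCarrier C) where
  /-- [DEFINITIONAL] `C([U(W)])` with the sup norm ([U(W)] is compact, l. 384). -/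
  Cf : Type
  [instCf₁ : NormedAddCommGroup Cf]
  [instCf₂ : NormedSpace ℂ Cf]
  [instCf₃ : CompleteSpace Cf]
  /-- [DEFINITIONAL] the bounded inclusion `C([U(W)]) ⊆ L²([U(W)])` (finite invariant measure). -/
  j : Cf →L[ℂ] H
  /-- [DEFINITIONAL] right translation `(R(h)x)(g) = x(gh)` on `C([U(W)])` (isometric). -/
  Rc : G →* (Cf →L[ℂ] Cf)
  /-- [DEFINITIONAL] `R` on `L²` restricts to `R` on `C([U(W)])`. -/
  j_R : ∀ (g : G) (x : Cf), j (Rc g x) = C.R g (j x)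
  /-- [DEFINITIONAL] evaluation of a continuous function at the class of `g ∈ U(W)(𝔸)`. -/
  ev : G → (Cf →L[ℂ] ℂ)
  /-- [DEFINITIONAL] `(R(h)x)(g) = x(gh)`. -/
  ev_R : ∀ (g h : G) (x : Cf), ev g (Rc h x) = ev (g * h) x
  /-- [DEFINITIONAL] a continuous function on `[U(W)]` is continuous on `U(W)(𝔸)`. -/
  ev_cont : ∀ x : Cf, Continuous fun g => ev g x
  /-- [DEFINITIONAL] a function vanishing at every point is zero. -/
  ev_sep : ∀ x : Cf, (∀ g, ev g x = 0) → x = 0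
  /-- [DEFINITIONAL] `U(W)(L₀) ⊂ U(W)(𝔸)`. -/
  Γ : Subgroup G
  /-- [DEFINITIONAL] functions on `[U(W)]` are left `U(W)(L₀)`-invariant (l. 430). -/
  ev_left : ∀ γ ∈ Γ, ∀ (g : G) (x : Cf), ev (γ * g) x = ev g x
  /-- [DEFINITIONAL] the compact torus `T(L₀⊗ℝ) ≅ U(1)^{2[L₀:ℚ]}` (l. 387). -/
  Tc : Type
  [instTc₁ : Group Tc]
  [instTc₂ : TopologicalSpace Tc]
  [instTc₃ : IsTopologicalGroup Tc]
  [instTc₄ : CompactSpace Tc]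
  [instTc₅ : MeasurableSpace Tc]
  [instTc₆ : BorelSpace Tc]
  /-- [DEFINITIONAL] the Haar probability measure `dt` on `T(L₀⊗ℝ)` (l. 390). -/
  μ : Measure Tc
  [instμ₁ : IsProbabilityMeasure μ]
  [instμ₂ : μ.IsMulLeftInvariant]
  /-- [DEFINITIONAL] `T(L₀⊗ℝ) ⊂ U(W)(L₀⊗ℝ) ⊂ U(W)(𝔸)`. -/
  ιT : Tc →* G
  /-- [DEFINITIONAL] the archimedean type `w`, a continuous unitary character of `T(L₀⊗ℝ)` (ll. 387–388). -/
  w : Tc →* ℂ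
  w_cont : Continuous w
  w_norm : ∀ t, ‖w t‖ = 1
  /-- [DEFINITIONAL] `t ↦ R(t)x` is sup-norm continuous for `x ∈ C([U(W)])` (uniform continuity on the compact `[U(W)]`). -/
  Rc_cont : ∀ x : Cf, Continuous fun t => Rc (ιT t) x
  /-- [DEFINITIONAL] (replaces `Pw_def`, input 1 of `WeightProjection.RepTorusCarrier_Pw_apply`) `t ↦ R(t)v` is
  `L²`-continuous along the torus (strong continuity of the regular representation; over the cocompact model
  `QuotientSmoothing.continuous_ρ_apply`). -/
  R_cont : ∀ v : H, Continuous fun t => C.R (ιT t) v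
  /-- [DEFINITIONAL] (replaces `Pw_def`, input 2) the carrier's torus family `(D.torus, D.w)` (ll. 387–391) has the joint
  eigenspace of `(ιT, w)`: `rfl` when `D.torus = ⇑ιT`, `D.w = ⇑w`; `WeightProjection.Ew_comp_of_surjective` for a reindexing. -/
  Ew_eq : D.Ew = RepDecomp.Ew C.R ιT w
  /-- [DEFINITIONAL] the set of ALL continuous characters of the compact abelian group `[T]`. -/
  Xall : Type
  /-- [DEFINITIONAL] the carrier's `D.X` is the subset of characters of archimedean type `w` (ll. 398–400, 409). -/
  emb : D.X → Xall
  /-- [DEFINITIONAL] the archimedean component `ξ_∞ := ξ ∘ (T(L₀⊗ℝ) → [T])` of a character of `[T]` (ll. 387–388). -/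
  χinf : Xall → (Tc →* ℂ)
  /-- [DEFINITIONAL] every character `ξ` of `[T]` with `ξ_∞ = w` belongs to the carrier's `D.X` (Step 2 indexes
  `E^χ_f` by ALL `χ` with `χ_∞ = w`: proof of Prop 3.6, l. 405 and ll. 409–410; not the Prop 3.6 hypothesis ll. 399–400,
  which Step 2 does not use — doc-only v2, was "(l. 398)"). -/
  emb_surj : ∀ ξ : Xall, χinf ξ = w → ∃ χ : D.X, emb χ = ξ
  /-- [DEFINITIONAL] the toric period `P_{T,ξ̄}(x) = ∫_{[T]} x(t) \overline{ξ(t)} dt` of a continuous function along the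
  compact `[T] ⊂ [U(W)]` (ll. 424–427), a sup-norm continuous linear functional. -/
  PT : Xall → (Cf →L[ℂ] ℂ)
  /-- [ELEMENTARY] covariance of the toric period under `T(L₀⊗ℝ)` (ll. 427–429). -/
  PT_cov : ∀ (ξ : Xall) (t : Tc) (x : Cf), PT ξ (Rc (ιT t) x) = χinf ξ t * PT ξ x
  /-- [DEFINITIONAL] `U(W)(𝔸_f)`. -/
  Gf : Type
  [instGf : Group Gf]
  /-- [DEFINITIONAL] `U(W)(𝔸_f) ⊂ U(W)(𝔸)`. -/
  ιf : Gf →* G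
  /-- [DEFINITIONAL] `U(W)(𝔸_f)` and `T(L₀⊗ℝ)` commute in `U(W)(𝔸)` (l. 426). -/
  comm : ∀ (hf : Gf) (t : Tc), ιf hf * ιT t = ιT t * ιf hf
  /-- [AX12(ii)] (ll. 423–426) the second unfolding identity of the pseudo-Eisenstein vectors + the fundamental lemma of
  the calculus of variations, in the consequence form Step 2 consumes (verbatim `AnnihilationDatum.unfold`). -/
  unfold : ∀ (x : Cf) (χ : D.X), (∀ f, ⟪D.E χ f, j x⟫ = 0) → ∀ h : G, PT (emb χ) (Rc h x) = 0
  /-- [DEFINITIONAL] `T(𝔸)`. -/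
  TA : Type
  /-- [DEFINITIONAL] `T(𝔸) ⊂ U(W)(𝔸)`. -/
  ιA : TA → G
  /-- [PRINT] completeness of the characters of the compact abelian group `[T]` (verbatim `AnnihilationDatum.fourier`;
  kernel supplement `CharCompleteness.lean`). -/
  fourier : ∀ x : Cf, (∀ ξ : Xall, PT ξ x = 0) → ∀ t : TA, ev (ιA t) x = 0
  /-- [PRINT] real approximation ⇒ `U(W)(L₀)·T(𝔸)·U(W)(𝔸_f)` dense in `U(W)(𝔸)` (verbatim `AnnihilationDatum.dense`;
  kernel supplement `AnnihilationDense.lean`). -/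
  dense : Dense {g : G | ∃ γ ∈ Γ, ∃ (t : TA) (hf : Gf), g = γ * ιA t * ιf hf}
  /-- [SETUP D7] an approximate identity through the operators `R(f_n)` (verbatim; kernel supplement `AnnihilationSm.lean`). -/
  sm : ℕ → (H →L[ℂ] H)
  /-- [SETUP D7] `R(f_n)v → v`. -/
  sm_tendsto : ∀ v : H, Tendsto (fun n => sm n v) atTop (𝓝 v)
  /-- [SETUP D7] `R(f_n)` preserves every closed `R(U(W)(𝔸))`-invariant subspace. -/
  sm_mem : ∀ (M : Submodule ℂ H), IsClosed (M : Set H) → (∀ (g : G), ∀ v ∈ M, C.R g v ∈ M) →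
    ∀ (n : ℕ), ∀ v ∈ M, sm n v ∈ M
  /-- [SETUP D7] `R(f_n)v` is a continuous function on `[U(W)]` (kernel over the model: `QuotientSmoothing.sm_cont_model`). -/
  sm_cont : ∀ (n : ℕ) (v : H), ∃ x : Cf, j x = sm n v

attribute [instance] RepAnnihilationDatum.instCf₁ RepAnnihilationDatum.instCf₂ RepAnnihilationDatum.instCf₃
  RepAnnihilationDatum.instTc₁ RepAnnihilationDatum.instTc₂ RepAnnihilationDatum.instTc₃
  RepAnnihilationDatum.instTc₄ RepAnnihilationDatum.instTc₅ RepAnnihilationDatum.instTc₆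
  RepAnnihilationDatum.instμ₁ RepAnnihilationDatum.instμ₂ RepAnnihilationDatum.instGf

namespace RepAnnihilationDatum

variable {C : RepCoreCarrier H HG CG G SK SigIdxG} {D : RepTorusCarrier C}
variable (A : RepAnnihilationDatum C D)

/-- `P_w` on the continuous model: `Pc x := ∫ conj(w t) • R(t) x dt ∈ C([U(W)])`. -/
def Pc (x : A.Cf) : A.Cf := proj A.μ A.Rc A.ιT A.w x

/-- **`P_w (j x) = j (Pc x)`** — now from the THEOREM `WeightProjection.RepTorusCarrier_Pw_apply` (unitarity from
`C.Analytic.R_unitary`) instead of the deleted field `Pw_def`. -/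
theorem Pw_j (hC : C.Analytic) (x : A.Cf) : D.toTorusCarrier.Pw (A.j x) = A.j (A.Pc x) := by
  rw [WeightProjection.RepTorusCarrier_Pw_apply A.μ D hC.isUnitaryRep A.w_cont A.w_norm A.R_cont A.Ew_eq, Pc, proj,
    ← A.j.integral_comp_comm (integrable_integrand A.w_cont A.Rc_cont x)]
  congr 1
  funext t
  rw [map_smul, A.j_R]

/-- `R(h_f)` commutes with `Pc` (l. 426). -/
theorem Rc_Pc (hf : A.Gf) (x : A.Cf) : A.Rc (A.ιf hf) (A.Pc x) = A.Pc (A.Rc (A.ιf hf) x) := by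
  refine proj_comm A.w_cont A.Rc_cont (A.Rc (A.ιf hf)) ?_ x
  intro t y
  rw [← mul_apply_eq_comp, ← map_mul, A.comm, map_mul, mul_apply_eq_comp]

/-- All Fourier coefficients of `(R(h_f)v_w)|_{[T]}` vanish (ll. 426–430), for a continuous `x` orthogonal to every
`E^χ_f`. -/
theorem period_transl_Pc_eq_zero (x : A.Cf) (hx : ∀ χ f, ⟪D.E χ f, A.j x⟫ = 0) (ξ : A.Xall)
    (hf : A.Gf) : A.PT ξ (A.Rc (A.ιf hf) (A.Pc x)) = 0 := by
  rw [A.Rc_Pc]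
  by_cases hξ : A.χinf ξ = A.w
  · obtain ⟨χ, hχ⟩ := A.emb_surj ξ hξ
    have hcov : ∀ (t : A.Tc) (y : A.Cf), A.PT ξ (A.Rc (A.ιT t) y) = A.w t * A.PT ξ y := by
      intro t y
      rw [A.PT_cov, hξ]
    rw [Pc, period_proj_self A.w_cont A.w_norm A.Rc_cont (A.PT ξ) hcov, ← hχ]
    exact A.unfold x χ (hx χ) (A.ιf hf)
  · rw [Pc, period_proj_ne A.w_cont A.w_norm A.Rc_cont (A.PT ξ) (A.χinf ξ) (A.PT_cov ξ) hξ]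

/-- `v_w` vanishes on the dense set `U(W)(L₀)T(𝔸)U(W)(𝔸_f)`, hence `v_w = 0` (ll. 430–434), for a continuous `x`
orthogonal to every `E^χ_f`. -/
theorem Pc_eq_zero (x : A.Cf) (hx : ∀ χ f, ⟪D.E χ f, A.j x⟫ = 0) : A.Pc x = 0 := by
  apply A.ev_sep
  have hS : ∀ g ∈ {g : G | ∃ γ ∈ A.Γ, ∃ (t : A.TA) (hf : A.Gf), g = γ * A.ιA t * A.ιf hf},
      A.ev g (A.Pc x) = 0 := by
    rintro g ⟨γ, hγ, t, hf, rfl⟩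
    rw [mul_assoc, A.ev_left γ hγ, ← A.ev_R]
    exact A.fourier _ (fun ξ => A.period_transl_Pc_eq_zero x hx ξ hf) t
  have hclosed : IsClosed {g : G | A.ev g (A.Pc x) = 0} :=
    isClosed_eq (A.ev_cont (A.Pc x)) continuous_const
  have hsub : closure {g : G | ∃ γ ∈ A.Γ, ∃ (t : A.TA) (hf : A.Gf), g = γ * A.ιA t * A.ιf hf}
      ⊆ {g : G | A.ev g (A.Pc x) = 0} := hclosed.closure_subset_iff.mpr hS
  intro g
  exact hsub (A.dense.closure_eq ▸ Set.mem_univ g)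

/-- Step 2 for CONTINUOUS vectors orthogonal to every `E^χ_f`: `P_w (j x) = 0`. -/
theorem Pw_j_eq_zero (hC : C.Analytic) (x : A.Cf) (hx : ∀ χ f, ⟪D.E χ f, A.j x⟫ = 0) :
    D.toTorusCarrier.Pw (A.j x) = 0 := by
  rw [A.Pw_j hC, A.Pc_eq_zero x hx, map_zero]

end RepAnnihilationDatum

/-- `𝓔̄^⊥` = the annihilator of all pseudo-Eisenstein vectors of the gen-3 torus side (l. 423). -/
def repAnnih {C : RepCoreCarrier H HG CG G SK SigIdxG} (D : RepTorusCarrier C) : Submodule ℂ H where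
  carrier := {v | ∀ χ f, ⟪D.E χ f, v⟫ = 0}
  add_mem' := by
    intro u v hu hv χ f
    simp only [Set.mem_setOf_eq] at hu hv ⊢
    rw [inner_add_right, hu χ f, hv χ f, add_zero]
  zero_mem' := by
    intro χ f
    exact inner_zero_right _
  smul_mem' := by
    intro c v hv χ f
    simp only [Set.mem_setOf_eq] at hv ⊢
    rw [inner_smul_right, hv χ f, mul_zero]

/-- (Ported verbatim from the HodgeCMPerL package; no docstring in the source.) -/
theorem mem_repAnnih {C : RepCoreCarrier H HG CG G SK SigIdxG} (D : RepTorusCarrier C) (v : H) :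
    v ∈ repAnnih D ↔ ∀ χ f, ⟪D.E χ f, v⟫ = 0 := Iff.rfl

/-- `𝓔̄^⊥` is closed. -/
theorem repAnnih_closed {C : RepCoreCarrier H HG CG G SK SigIdxG} (D : RepTorusCarrier C) :
    IsClosed ((repAnnih D : Submodule ℂ H) : Set H) := by
  have h : ((repAnnih D : Submodule ℂ H) : Set H) = ⋂ χ, ⋂ f, {v : H | ⟪D.E χ f, v⟫ = 0} := by
    ext v
    simp only [SetLike.mem_coe, mem_repAnnih, Set.mem_iInter, Set.mem_setOf_eq]
  rw [h]
  exact isClosed_iInter fun χ => isClosed_iInter fun f =>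
    isClosed_eq (continuous_const.inner continuous_id) continuous_const

/-- `𝓔̄^⊥` is `R(U(W)(𝔸))`-invariant (l. 423): by unitarity AX9 and `R(h₀)E^χ_f = E^χ_{f^{h₀}}` (`AX12_E_transl`,
ll. 410–411). -/
theorem repAnnih_invariant {C : RepCoreCarrier H HG CG G SK SigIdxG} (D : RepTorusCarrier C) (hC : C.Analytic)
    (hT : ∀ (h : G) (χ : D.X) (f : D.TestFn), C.R h (D.E χ f) = D.E χ (D.ETransl h χ f)) :
    ∀ (g : G), ∀ v ∈ repAnnih D, C.R g v ∈ repAnnih D := by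
  intro g v hv χ f
  show ⟪D.E χ f, C.R g v⟫ = 0
  have h1 : D.E χ f = C.R g (C.R g⁻¹ (D.E χ f)) := by
    rw [← mul_apply_eq_comp, ← map_mul, mul_inv_cancel, map_one, one_apply_eq_self]
  rw [h1, hC.R_unitary, hT]
  exact hv χ _

namespace RepAnnihilationDatum

variable {C : RepCoreCarrier H HG CG G SK SigIdxG} {D : RepTorusCarrier C}

/-- **N23c = PerL v5 Prop 3.6 Step 2 (ll. 423–434) on the gen-3 carrier**: a vector orthogonal to every `E^χ_f` has
vanishing `w`-part — `P_w v = 0` for the DEFINED `P_w` (orthogonal projection onto the closed joint `w`-eigenspace). -/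
theorem annihilation (A : RepAnnihilationDatum C D) (hC : C.Analytic)
    (hT : ∀ (h : G) (χ : D.X) (f : D.TestFn), C.R h (D.E χ f) = D.E χ (D.ETransl h χ f))
    (v : H) (hv : ∀ χ f, ⟪D.E χ f, v⟫ = 0) : D.toTorusCarrier.Pw v = 0 := by
  have hmem : ∀ n, A.sm n v ∈ repAnnih D :=
    fun n => A.sm_mem (repAnnih D) (repAnnih_closed D) (repAnnih_invariant D hC hT) n v hv
  have hzero : ∀ n, D.toTorusCarrier.Pw (A.sm n v) = 0 := by
    intro n
    obtain ⟨x, hx⟩ := A.sm_cont n v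
    rw [← hx]
    refine A.Pw_j_eq_zero hC x ?_
    intro χ f
    rw [hx]
    exact hmem n χ f
  have hlim : Tendsto (fun n => D.toTorusCarrier.Pw (A.sm n v)) atTop (𝓝 (D.toTorusCarrier.Pw v)) :=
    (D.toTorusCarrier.Pw.continuous.tendsto v).comp (A.sm_tendsto v)
  have hlim0 : Tendsto (fun n => D.toTorusCarrier.Pw (A.sm n v)) atTop (𝓝 (0 : H)) := by
    simp_rw [hzero]
    exact tendsto_const_nhds
  exact tendsto_nhds_unique hlim hlim0

/-- **The field `RepTorusCarrier.Analytic.AX8_annihilation`, DISCHARGED** from a `RepAnnihilationDatum`, unitarity (in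
`C.Analytic`) and the sibling field `AX12_E_transl` — verbatim its type. -/
theorem AX8_annihilation (A : RepAnnihilationDatum C D) (hC : C.Analytic)
    (hT : ∀ (h : G) (χ : D.X) (f : D.TestFn), C.R h (D.E χ f) = D.E χ (D.ETransl h χ f)) :
    ∀ v : H, (∀ χ f, ⟪D.E χ f, v⟫ = 0) → D.toTorusCarrier.Pw v = 0 :=
  fun v hv => A.annihilation hC hT v hv

end RepAnnihilationDatum

/-- **The five AX5b/AX12 fields of `RepTorusCarrier.Analytic`** — everything but `AX8_annihilation` (field names and
types verbatim). -/
structure _root_.HodgeCM.RepTorusCarrier.Analytic5 {C : RepCoreCarrier H HG CG G SK SigIdxG} (D : RepTorusCarrier C) :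
    Prop where
  /-- AX5b: `Φ ↦ ϑ_{T,χ}(Φ)` is continuous into `C([G_U])`. -/
  AX5b_ϑ_cont : ∀ χ, Continuous (D.ϑc χ)
  /-- AX12: `h ↦ ϑ_{T,χ}(ω(h)Φ)` is continuous `U(W)(𝔸) → C([G_U])`. -/
  AX12_transl_cont : ∀ χ (Φ : SK), Continuous fun h : G => D.ϑc χ (C.omg h Φ)
  /-- ll. 410–411: `R(h₀) E^χ_f = E^χ_{f^{h₀}}`. -/
  AX12_E_transl : ∀ (h : G) χ f, C.R h (D.E χ f) = D.E χ (D.ETransl h χ f)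
  /-- AX12, first unfolding identity, integral-free. -/
  AX12_unfold_lift : ∀ (Φ : SK) χ f, (C.toCoreCarrier.TΦ Φ) (D.E χ f) ∈ (Submodule.span ℂ
    (Set.range fun h : G => C.inclCG (D.ϑc χ (C.omg h Φ)))).topologicalClosure
  /-- AX12 + AX5b, the approximate-identity limit of Thm 3.7's proof. -/
  AX12_molly : ∀ χ (Φ : SK),
    C.inclCG (D.ϑc χ Φ) ∈ closure (Set.range fun f : D.TestFn => (C.toCoreCarrier.TΦ Φ) (D.E χ f))

/-- (Ported verbatim from the HodgeCMPerL package; no docstring in the source.) -/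
theorem _root_.HodgeCM.RepTorusCarrier.Analytic.analytic5 {C : RepCoreCarrier H HG CG G SK SigIdxG}
    {D : RepTorusCarrier C} (h : D.Analytic) : D.Analytic5 where
  AX5b_ϑ_cont := h.AX5b_ϑ_cont
  AX12_transl_cont := h.AX12_transl_cont
  AX12_E_transl := h.AX12_E_transl
  AX12_unfold_lift := h.AX12_unfold_lift
  AX12_molly := h.AX12_molly

/-- **`RepTorusCarrier.Analytic` = `Analytic5` + a `RepAnnihilationDatum`** (given the core's AX9): AX8 is no longer an
input. -/
theorem analytic_of_analytic5 {C : RepCoreCarrier H HG CG G SK SigIdxG} {D : RepTorusCarrier C}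
    (h5 : D.Analytic5) (A : RepAnnihilationDatum C D) (hC : C.Analytic) : D.Analytic where
  AX5b_ϑ_cont := h5.AX5b_ϑ_cont
  AX12_transl_cont := h5.AX12_transl_cont
  AX12_E_transl := h5.AX12_E_transl
  AX12_unfold_lift := h5.AX12_unfold_lift
  AX12_molly := h5.AX12_molly
  AX8_annihilation := A.AX8_annihilation hC h5.AX12_E_transl

/-- **`RepTorusCarrier.Analytic` with AX8 DISCHARGED**: the six-field analytic record of a gen-3 torus side assembled from
its five AX5b/AX12 fields and a `RepAnnihilationDatum` — `AX8_annihilation` is no longer an input. -/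
theorem analytic_of_repAnnihilationDatum {C : RepCoreCarrier H HG CG G SK SigIdxG} {D : RepTorusCarrier C}
    (A : RepAnnihilationDatum C D) (hC : C.Analytic)
    (h5b : ∀ χ, Continuous (D.ϑc χ))
    (h12a : ∀ χ (Φ : SK), Continuous fun h : G => D.ϑc χ (C.omg h Φ))
    (hT : ∀ (h : G) (χ : D.X) (f : D.TestFn), C.R h (D.E χ f) = D.E χ (D.ETransl h χ f))
    (h12c : ∀ (Φ : SK) χ f, (C.toCoreCarrier.TΦ Φ) (D.E χ f) ∈ (Submodule.span ℂ
      (Set.range fun h : G => C.inclCG (D.ϑc χ (C.omg h Φ)))).topologicalClosure)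
    (h12d : ∀ χ (Φ : SK),
      C.inclCG (D.ϑc χ Φ) ∈ closure (Set.range fun f : D.TestFn => (C.toCoreCarrier.TΦ Φ) (D.E χ f))) :
    D.Analytic where
  AX5b_ϑ_cont := h5b
  AX12_transl_cont := h12a
  AX12_E_transl := hT
  AX12_unfold_lift := h12c
  AX12_molly := h12d
  AX8_annihilation := A.AX8_annihilation hC hT

end LayerCRep

end PerL34.Annihilation

end HodgeCM

end
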